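import Literature.AnabelianGeometry.EtaleTheta.CyclotomeTowerAllLevels
import HarnessLib

/-!
# [EtTh] §2 over §1: the instantiated tower of theta environments — re-chaining of the cyclotomes and
# level bookkeeping (support file of the merge adapter W2-L2-04, part 4)

Mochizuki, *The étale theta function …*, Publ. RIMS **45** (2009), §2, Def. 2.13 (ii) p. 48 ("the mod
`N'` mono-theta environment induced by `M`") and Cor. 2.19 (ii) p. 64 [cite: MochizukiEtTh2009, Cor 2.19 (ii) p.64].
Layer L2 of the abc-iut cell, seat abc-iut-L2-t8 (gen 2); continuation of `TowerOfSetting.lean`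
(`ThetaSetting.CyclotomeTower`, `EtaleThetaData.DoubleUnderline.thetaEnvTower`) and of
`CyclotomeTowerAllLevels.lean` (seat abc-iut-w4-d024: all-level identifications `modAll`, the generic
constructor `CyclotomeTower.ofAllLevels`, and the `rfl` level bookkeeping `thetaEnvTower_level`,
`thetaEnvTower_red`, `thetaEnvTower_redEnv_left/right/eq`, which are NOT repeated here — v2 of this file,
written for the [IUTchII] §1 consumers, bridge B8 part 5, seats abc-iut-w4-d024 / w4-d030):

* `ThetaSetting.CyclotomeTower.ofFamily` — the constructor `ofAllLevels` with the index set explicit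
  (the name announced to the consumers; `ofFamily_eq_ofAllLevels`, `ofFamily_mod` are `rfl`);
* `ThetaSetting.CyclotomeTower.restrict` — restriction of a tower to a smaller admissible index set;
* `thetaEnvTower_level_env` — the level-`M` cyclotomic envelope of the instantiated tower IS that of the
  instantiated level-`M` data (`rfl`).

DATA/bookkeeping only; nothing of [EtTh] is asserted; no side is taken on any disputed claim.
-/

noncomputable section

namespace Literature.AnabelianGeometry.EtaleTheta

open Literature.AnabelianGeometry.SemiGraphs

namespace ThetaSetting

variable {p : ℕ} [Fact p.Prime] {D : ThetaSetting p} {l : ℕ}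

/-- **Re-chaining of compatible cyclotome identifications** ("the mod `N'` … environment induced by `M`",
Def. 2.13 (ii); level-wise form of "`Δ_Θ (≅ Ẑ(1))`", p. 12): a family of identifications
`(l·Δ_Θ) ↠ μ_M` at every level `M ≥ 1`, compatible with all the power maps `μ_{M'} ↠ μ_M` (`M ∣ M'`),
restricts to a `CyclotomeTower` over any index set `E' ∋ 1` that is cofinal in `(ℕ≥1, ∣)` and totally
ordered by divisibility. [cite: MochizukiEtTh2009, Def 2.13 (ii) p.48] -/
def CyclotomeTower.ofFamily (mods : ∀ M : ℕ+, D.CyclotomeMod l M)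
    (hmods : ∀ (M M' : ℕ+) (h : (M : ℕ) ∣ (M' : ℕ)) (x : D.lDeltaTheta l),
      MuN.red p M M' h ((mods M').red x) = (mods M).red x)
    (E' : Set ℕ+) (h1 : (1 : ℕ+) ∈ E') (hcof : ∀ n : ℕ+, ∃ M ∈ E', n ∣ M)
    (htot : ∀ M ∈ E', ∀ M' ∈ E', M ∣ M' ∨ M' ∣ M) : D.CyclotomeTower l E' :=
  CyclotomeTower.ofAllLevels mods hmods h1 hcof htot

/-- `ofFamily` IS abc-iut-w4-d024's `ofAllLevels` (one object, two names). [cite: MochizukiEtTh2009, Def 2.13 (ii) p.48] -/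
theorem CyclotomeTower.ofFamily_eq_ofAllLevels (mods : ∀ M : ℕ+, D.CyclotomeMod l M)
    (hmods : ∀ (M M' : ℕ+) (h : (M : ℕ) ∣ (M' : ℕ)) (x : D.lDeltaTheta l),
      MuN.red p M M' h ((mods M').red x) = (mods M).red x)
    (E' : Set ℕ+) (h1 : (1 : ℕ+) ∈ E') (hcof : ∀ n : ℕ+, ∃ M ∈ E', n ∣ M)
    (htot : ∀ M ∈ E', ∀ M' ∈ E', M ∣ M' ∨ M' ∣ M) :
    CyclotomeTower.ofFamily mods hmods E' h1 hcof htot = CyclotomeTower.ofAllLevels mods hmods h1 hcof htot :=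
  rfl

/-- The level-`M` identification of the re-chained tower is the given one (definitional).
[cite: MochizukiEtTh2009, Def 2.13 (ii) p.48] -/
@[simp] theorem CyclotomeTower.ofFamily_mod (mods : ∀ M : ℕ+, D.CyclotomeMod l M)
    (hmods : ∀ (M M' : ℕ+) (h : (M : ℕ) ∣ (M' : ℕ)) (x : D.lDeltaTheta l),
      MuN.red p M M' h ((mods M').red x) = (mods M).red x)
    (E' : Set ℕ+) (h1 : (1 : ℕ+) ∈ E') (hcof : ∀ n : ℕ+, ∃ M ∈ E', n ∣ M)
    (htot : ∀ M ∈ E', ∀ M' ∈ E', M ∣ M' ∨ M' ∣ M) (M : E') :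
    (CyclotomeTower.ofFamily mods hmods E' h1 hcof htot).mod M = mods M := rfl

/-- Restriction of a tower to a smaller admissible index set (sub-chain), e.g. to pull a tower theorem
down to one pair `M ∣ M'` through `{1, M, M'}`. [cite: MochizukiEtTh2009, Def 2.13 (ii) p.48] -/
def CyclotomeTower.restrict {Es : Set ℕ+} (τ : D.CyclotomeTower l Es) (E' : Set ℕ+) (hE' : E' ⊆ Es)
    (h1 : (1 : ℕ+) ∈ E') (hcof : ∀ n : ℕ+, ∃ M ∈ E', n ∣ M) : D.CyclotomeTower l E' where
  one_mem := h1
  cofinal := hcof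
  total M hM M' hM' := τ.total M (hE' hM) M' (hE' hM')
  mod M := τ.mod ⟨M, hE' M.2⟩
  red_mod M M' h x := τ.red_mod ⟨M, hE' M.2⟩ ⟨M', hE' M'.2⟩ h x

/-- The level-`M` identification of a restricted tower (definitional). [cite: MochizukiEtTh2009, Def 2.13 (ii) p.48] -/
@[simp] theorem CyclotomeTower.restrict_mod {Es : Set ℕ+} (τ : D.CyclotomeTower l Es) (E' : Set ℕ+)
    (hE' : E' ⊆ Es) (h1 : (1 : ℕ+) ∈ E') (hcof : ∀ n : ℕ+, ∃ M ∈ E', n ∣ M) (M : E') :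
    (τ.restrict E' hE' h1 hcof).mod M = τ.mod ⟨M, hE' M.2⟩ := rfl

namespace EtaleThetaData.DoubleUnderline

variable {E : D.EtaleThetaData} (C : E.DoubleUnderline l) {Es : Set ℕ+} (τ : D.CyclotomeTower l Es)

/-- The mod-`M'` cyclotomic envelope of level `M'` of the tower is that of `thetaEnvData (τ.mod M')`
(definitionally). [cite: MochizukiEtTh2009, Cor 2.19 (ii) p.64] -/
theorem thetaEnvTower_level_env (hC : D.Compat) (hS : D.Sec2Hyps) (M : Es) :
    ((C.thetaEnvTower τ hC hS).level M).env = (C.thetaEnvData (τ.mod M) hC hS).env := rfl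

end EtaleThetaData.DoubleUnderline

end ThetaSetting

end Literature.AnabelianGeometry.EtaleTheta

end
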